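import Mathlib
import Literature.Geometry.Lorentzian.FinalEraPackage2
import Summits.FinalStateConjecture.FinalStateConjecture.Theses.DissipativeFinalMotions
import Summits.FinalStateConjecture.FinalStateConjecture.Theorems.DissipativeFinalMotionsDispersalFromBudget
import HarnessLib

/-!
# Route DissipativeFinalMotions — `RadiativeLyapunovBudget` is equivalent to pairwise dispersal
# of every rev-2 final era (structure theorem, `--supports` stmt-FinalStateConjecture-10993)

The crux `RadiativeLyapunovBudget` (RLB) of the route `DissipativeFinalMotions` (summit
`FinalStateConjecture`) asks, for admissible data, a maximal vacuum Cauchy development with complete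
`𝓘⁺` and any rev-2 final-era package (the 31-clause inline hypothesis, by `Iff.rfl` the Literature
predicate `CauchyDevelopment.IsFinalEra₂`), for a function `E : ℝ → ℝ`, antitone and bounded
below on `[T, ∞)`, which drops by `ε(D') > 0` within a lag `L(D') ≥ 0` after every unit of flat
time during which two distinct labels stay `D'`-close.

This file records, sorry-free and GR-free, that the budget is **exactly** the statement that the
labels of every such package pairwise disperse, `‖ξᵢ(t) − ξⱼ(t)‖ → ∞` (`i ≠ j`):

* `budget_of_pairwise_tendsto` — pure real analysis: finitely many curves that pairwise disperse
  admit the budget `E(t) := exp (−t)` with lag `L := 1` and floor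
  `ε(D') := exp (−T₀(D')) (1 − exp (−1))`, `T₀(D')` a time after which every distinct pair is more
  than `D'` apart (so that a `D'`-close unit interval `[t, t + 1]` forces `t < T₀`);
* `radiativeLyapunovBudget_of_packageDisperses` — hence RLB follows from pairwise dispersal of
  every rev-2 package (no Bondi mass, no positivity, no flux floor is needed for the STATEMENT);
* `packageDisperses_of_radiativeLyapunovBudget` — conversely RLB forces pairwise dispersal of every
  rev-2 package, by the landed support item `DispersalFromBudget`
  (`Theorems.DispersalFromBudget_proof`) fed with the package's Lipschitz clause (conjunct 14);
* `radiativeLyapunovBudget_iff_packageDisperses` — the equivalence.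

Consequence for provers and planners (line `birth` of the crux, lead notes 2026-08-17): any line
for RLB must prove "no eternal loitering of two distinct certified holes" for the MGHD of arbitrary
admissible data; the Bondi ledger of `Lines/birth.lean` is one road to it, not part of the content.
The refuter's crux attack (item evidence `ReductionRoute.lean`, 2026-08-15, not landed) found the
same equivalence; this is an independent tree-side rendering against the landed
`DispersalFromBudget_proof`.

References: the dissipative Kepler problem (Margheri–Ortega–Rebelo, arXiv:1207.5001) is the
`N = 2` toy of the budget ⇒ dispersal direction; Marchal–Saari, J. Differential Equations 20
(1976) 150 (final evolutions of the `N`-body problem) for the dispersal vocabulary.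
-/

-- the doubled `FinalStateConjecture.FinalStateConjecture` path component trips dupNamespace
set_option linter.dupNamespace false

noncomputable section

open scoped Manifold ContDiff Topology
open Filter Set Literature.Geometry.Lorentzian

namespace Summit.FinalStateConjecture.FinalStateConjecture.Theorems.DissipativeFinalMotions

open Summit.FinalStateConjecture.FinalStateConjecture.Theses.DissipativeFinalMotions
  (RadiativeLyapunovBudget)

/-- **A GR-free budget for dispersing curves.** If finitely many curves
`ξ i : ℝ → ℝ³` pairwise disperse (`‖ξ i t - ξ j t‖ → ∞` for `i ≠ j`), then `E t := exp (-t)` is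
antitone and bounded below on `[T, ∞)` and, for every `D' > 0`, drops by
`ε := exp (-T₀) (1 - exp (-1)) > 0` within lag `L := 1` after every unit interval `[t, t + 1]`,
`t ≥ T`, on which two distinct curves are `D'`-close — because such a `t` is earlier than the
time `T₀` after which all distinct pairs are more than `D'` apart. [folklore] -/
theorem budget_of_pairwise_tendsto {N : ℕ} (T : ℝ) {ξ : Fin N → ℝ → EuclideanSpace ℝ (Fin 3)}
    (h : ∀ i j, i ≠ j → Tendsto (fun t ↦ ‖ξ i t - ξ j t‖) atTop atTop) :
    ∃ E : ℝ → ℝ, AntitoneOn E (Ici T) ∧ BddBelow (E '' Ici T) ∧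
      ∀ D' : ℝ, 0 < D' → ∃ ε L : ℝ, 0 < ε ∧ 0 ≤ L ∧ ∀ t, T ≤ t → ∀ i j, i ≠ j →
        (∀ s, t ≤ s → s ≤ t + 1 → ‖ξ i s - ξ j s‖ ≤ D') → E (t + L) ≤ E t - ε := by
  refine ⟨fun t ↦ Real.exp (-t), ?_, ?_, ?_⟩
  · intro s _ t _ hst
    exact Real.exp_le_exp.2 (neg_le_neg hst)
  · refine ⟨0, ?_⟩
    rintro _ ⟨t, -, rfl⟩
    exact (Real.exp_pos _).le
  · intro D' _
    -- eventually every distinct pair is more than `D'` apart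
    have hev : ∀ᶠ t in atTop, ∀ i j, i ≠ j → D' < ‖ξ i t - ξ j t‖ := by
      refine Filter.eventually_all.2 fun i ↦ Filter.eventually_all.2 fun j ↦ ?_
      by_cases hij : i = j
      · exact Filter.Eventually.of_forall fun t hne ↦ absurd hij hne
      · exact ((h i j hij).eventually_gt_atTop D').mono fun t ht _ ↦ ht
    obtain ⟨T₀, hT₀⟩ := Filter.eventually_atTop.1 hev
    have h1e : 0 < 1 - Real.exp (-1) := sub_pos.2 (Real.exp_lt_one_iff.2 (by norm_num))
    refine ⟨Real.exp (-T₀) * (1 - Real.exp (-1)), 1, mul_pos (Real.exp_pos _) h1e, zero_le_one,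
      fun t _ i j hij hclose ↦ ?_⟩
    -- a `D'`-close unit interval starting at `t` forces `t < T₀`
    have hlt : t < T₀ := by
      by_contra hle
      exact absurd (hclose t le_rfl (by linarith)) (not_le.2 (hT₀ t (not_lt.1 hle) i j hij))
    have hmono : Real.exp (-T₀) ≤ Real.exp (-t) := Real.exp_le_exp.2 (by linarith)
    have hsplit : Real.exp (-(t + 1)) = Real.exp (-t) * Real.exp (-1) := by
      rw [neg_add, Real.exp_add]
    show Real.exp (-(t + 1)) ≤ Real.exp (-t) - Real.exp (-T₀) * (1 - Real.exp (-1))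
    rw [hsplit]
    nlinarith [Real.exp_pos (-t), Real.exp_pos (-1)]

/-- **RLB from pairwise dispersal of every rev-2 final era.** If for admissible data, every maximal
vacuum Cauchy development with complete `𝓘⁺` and every rev-2 final-era package
(`CauchyDevelopment.IsFinalEra₂`, by `Iff.rfl` the inline hypothesis of the crux) the labels
pairwise disperse in the flat chart, then `RadiativeLyapunovBudget` holds — with the GR-free
witness of `budget_of_pairwise_tendsto`. [folklore] -/
theorem radiativeLyapunovBudget_of_packageDisperses
    (h : ∀ (X : Type) [TopologicalSpace X] [ChartedSpace E3 X] [IsManifold (𝓡 3) ∞ X] [T2Space X]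
      [SecondCountableTopology X] [ConnectedSpace X], ∀ D ∈ admissibleVacuumData X,
      ∀ 𝒟 : VacuumCauchyDevelopment D, 𝒟.IsMaximal →
      Summit.FinalStateConjecture.HasCompleteNullInfinity 𝒟.toCauchyDevelopment →
      ∀ (N : ℕ) (M a : Fin N → ℝ) (T δ V C₁ C₂ ρ₀ κ : ℝ) (ξ : Fin N → ℝ → E3) (β : ℝ → ℝ)
        (U₀ : TopologicalSpace.Opens E4) (B₀ : ModelBackground) (B : Fin N → ModelBackground)
        (Ψ₀ : B₀.domain → 𝒟.carrier) (Ψ : (i : Fin N) → (B i).domain → 𝒟.carrier)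
        (O : Set 𝒟.carrier),
        𝒟.toCauchyDevelopment.IsFinalEra₂ N M a T δ V C₁ C₂ ρ₀ κ ξ β U₀ B₀ B Ψ₀ Ψ O →
        ∀ i j, i ≠ j → Tendsto (fun t ↦ ‖ξ i t - ξ j t‖) atTop atTop) :
    RadiativeLyapunovBudget := by
  intro X _ _ _ _ _ _ D hD 𝒟 hmax hscri N M a T δ V C₁ C₂ ρ₀ κ ξ β U₀ B₀ B Ψ₀ Ψ O hera
  exact budget_of_pairwise_tendsto T
    (h X D hD 𝒟 hmax hscri N M a T δ V C₁ C₂ ρ₀ κ ξ β U₀ B₀ B Ψ₀ Ψ O hera)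

/-- **Pairwise dispersal of every rev-2 final era from RLB.** Conversely, `RadiativeLyapunovBudget`
forces the labels of every rev-2 final-era package (admissible data, maximal development, complete
`𝓘⁺`) to pairwise disperse: the budget `E` and the package's `V`-Lipschitz clause (conjunct 14)
feed the landed support item `DispersalFromBudget` (`DispersalFromBudget_proof`). [folklore] -/
theorem packageDisperses_of_radiativeLyapunovBudget (h : RadiativeLyapunovBudget) :
    ∀ (X : Type) [TopologicalSpace X] [ChartedSpace E3 X] [IsManifold (𝓡 3) ∞ X] [T2Space X]
      [SecondCountableTopology X] [ConnectedSpace X], ∀ D ∈ admissibleVacuumData X,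
      ∀ 𝒟 : VacuumCauchyDevelopment D, 𝒟.IsMaximal →
      Summit.FinalStateConjecture.HasCompleteNullInfinity 𝒟.toCauchyDevelopment →
      ∀ (N : ℕ) (M a : Fin N → ℝ) (T δ V C₁ C₂ ρ₀ κ : ℝ) (ξ : Fin N → ℝ → E3) (β : ℝ → ℝ)
        (U₀ : TopologicalSpace.Opens E4) (B₀ : ModelBackground) (B : Fin N → ModelBackground)
        (Ψ₀ : B₀.domain → 𝒟.carrier) (Ψ : (i : Fin N) → (B i).domain → 𝒟.carrier)
        (O : Set 𝒟.carrier),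
        𝒟.toCauchyDevelopment.IsFinalEra₂ N M a T δ V C₁ C₂ ρ₀ κ ξ β U₀ B₀ B Ψ₀ Ψ O →
        ∀ i j, i ≠ j → Tendsto (fun t ↦ ‖ξ i t - ξ j t‖) atTop atTop := by
  intro X _ _ _ _ _ _ D hD 𝒟 hmax hscri N M a T δ V C₁ C₂ ρ₀ κ ξ β U₀ B₀ B Ψ₀ Ψ O hera
  obtain ⟨E, hanti, hbdd, hcoer⟩ :=
    h X D hD 𝒟 hmax hscri N M a T δ V C₁ C₂ ρ₀ κ ξ β U₀ B₀ B Ψ₀ Ψ O hera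
  exact DispersalFromBudget_proof N T V ξ E hera.2.2.2.2.2.2.2.2.2.2.2.2.2.1 hanti hbdd hcoer

/-- **`RadiativeLyapunovBudget` ⟺ pairwise dispersal of every rev-2 final era.** The crux of the
route `DissipativeFinalMotions` is equivalent to: for admissible data, every maximal vacuum Cauchy
development with complete `𝓘⁺` and every rev-2 final-era package has pairwise dispersing labels.
(`radiativeLyapunovBudget_of_packageDisperses` and `packageDisperses_of_radiativeLyapunovBudget`.)
[folklore] -/
theorem radiativeLyapunovBudget_iff_packageDisperses : open Literature.Geometry.Lorentzian Filter in open scoped Manifold ContDiff in Summit.FinalStateConjecture.FinalStateConjecture.Theses.DissipativeFinalMotions.RadiativeLyapunovBudget ↔ ∀ (X : Type) [TopologicalSpace X] [ChartedSpace E3 X] [IsManifold (𝓡 3) ∞ X] [T2Space X] [SecondCountableTopology X] [ConnectedSpace X], ∀ D ∈ admissibleVacuumData X, ∀ 𝒟 : VacuumCauchyDevelopment D, 𝒟.IsMaximal → Summit.FinalStateConjecture.HasCompleteNullInfinity 𝒟.toCauchyDevelopment → ∀ (N : ℕ) (M a : Fin N → ℝ) (T δ V C₁ C₂ ρ₀ κ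 : ℝ) (ξ : Fin N → ℝ → E3) (β : ℝ → ℝ) (U₀ : TopologicalSpace.Opens E4) (B₀ : ModelBackground) (B : Fin N → ModelBackground) (Ψ₀ : B₀.domain → 𝒟.carrier) (Ψ : (i : Fin N) → (B i).domain → 𝒟.carrier) (O : Set 𝒟.carrier), 𝒟.toCauchyDevelopment.IsFinalEra₂ N M a T δ V C₁ C₂ ρ₀ κ ξ β U₀ B₀ B Ψ₀ Ψ O → ∀ i j : Fin N, i ≠ j → Tendsto (fun t ↦ ‖ξ i t - ξ j t‖) atTop atTop :=
  ⟨packageDisperses_of_radiativeLyapunovBudget, radiativeLyapunovBudget_of_packageDisperses⟩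

end Summit.FinalStateConjecture.FinalStateConjecture.Theorems.DissipativeFinalMotions

end
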